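/-
Copyright (c) 2026 the pub-hodgecm-mathlib formalisation cell (harness21).  Prover seat hodgecm-mathlib-K2E1-p14 (g2) (R90-TF S8 «E-S8-def» deal (n2), R90-CS-plan 16:08:55Z),
Track B «K2-LIT» ENGINE E1, h413 = `stmt-HodgeConjecture-24833`, route `HCCMUnconditional`: the CENTRE VALUE of THE pinned scattering scalar, `s(½)² = 1`, read back through the
ONE data tuple of ★ `K2E1ContSpecTraceNumbersU2Defs`, and its corollaries for the continuous-spectrum trace numbers.
-/
import Summits.HodgeConjecture.HodgeConjecture.Theorems.K2E1ContSpecTraceNumbersU2Defs           -- ★ p861755 ∕ p861840 (D-S8-2): `scatteringScalarM1`, `scatteringPolesM1`, `trIH_m1`, `trMIH_m1` + read-backs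
import Summits.HodgeConjecture.HodgeConjecture.Theorems.K2E1ChiScatteringCentreValueSignM1CMTwo  -- ★ p861469: `apply_half_eq_one_or_eq_neg_one_of_fe_of_conj` (kernel-free `s(½) = ±1`)
import HarnessLib

/-!
# `K2E1ContSpecTraceNumbersCentreSqU2` — THE CENTRE VALUE OF THE PINNED SCATTERING SCALAR: `s(½)² = 1`, `½ ∉` ITS SINGULAR SET, `Tr(M_H(χ) I_{H,χ}(f)) = ± Tr I_{H,χ}(f)`
# (R90-TF S8 «E-S8-def» deal (n2); read-backs through the ONE data tuple of ★ `K2E1ContSpecTraceNumbersU2Defs`)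

Track B ∕ K2-LIT, crux h413 = `stmt-HodgeConjecture-24833`, route of record `HCCMUnconditional`; cell `hodgecm-mathlib`, R90-TF slab S8 (ContSpec-n½).  HELPER FILE
(`--supports stmt-HodgeConjecture-24833 --as helper`): theorems only, no `def`, no `instance`, no named-fact hypothesis, no `sorry`, DEFAULT heartbeats throughout.

THE MATHEMATICS ([MoeglinWaldspurger1995, IV.1.10 (functional equation `M(w,1-z̄ᶜ)M(w,z) = 1`), IV.3.12]; [KeysShahidi1988, Thm. 5.1]; [Rogawski1990, §13.6 (13.6.1) p. 208]).
`s := scatteringScalarM1 …` is THE scattering scalar of the ONE pinned package (★ `chi_scattering_real_poles_m1_complete_cm_two`, `Classical.choose`); on it the functional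
equation `s(z) s(1-z) = 1` (★ σ2 `chi_scattering_fe_m1_cm_two`, from the package's Eisenstein clauses) and the conjugation symmetry `s(conj z) = conj (s z)` (★
`chi_scattering_conj_symm_m1_cm_two`, from the tube formula, `χ = wχ`, `φ(1) ∈ ℝ`) hold off the package's closed co-discrete pole set, whence (★ kernel-free
`apply_half_eq_one_or_eq_neg_one_of_fe_of_conj`, ★ `analyticAt_of_re_eq_half_of_fe_of_conj`) `s` is analytic at `½` and **`s(½) = 1 ∨ s(½) = -1`**: the SIGN itself is
external content (Keys–Shahidi), not a convention — S8's socket `sock_S8_ext_kysCentreU2` keeps it as a disjunction.  Consequently `½ ∉ scatteringPolesM1 …` (the singular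
set) and `Tr(M_H(χ) I_{H,χ}(f)) = s(½) · Tr I_{H,χ}(f) = ± Tr I_{H,χ}(f)`, `(Tr(M_H(χ) I_{H,χ}(f)))² = (Tr I_{H,χ}(f))²`.
ONE SOURCE (R90-CS-audit1 (n1)): every statement below is about the `def`s of ★ `K2E1ContSpecTraceNumbersU2Defs` at ONE binder tuple; §1 `scatteringScalarM1_eq_choose` is THE
conversion lemma of record (`rfl`: the def IS the fourth coordinate of the chosen tuple) — consumers `rw` with it and project the SAME tuple's clauses, never re-choose.
* §1 `scatteringScalarM1_eq_choose` (`rfl`).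
* §2 `scatteringScalarM1_half_eq_or_and_analyticAt` (the (FE)+(conj) chain on the chosen clauses), heads `scatteringScalarM1_half_eq_one_or_eq_neg_one`, `analyticAt_scatteringScalarM1_half`,
  `scatteringScalarM1_half_sq`, `half_notMem_scatteringPolesM1`.
* §3 `trMIH_m1_eq_or_eq_neg`, `trMIH_m1_sq` (the trace-number corollaries).
HONEST LABEL: HC_CM is proved only modulo the 7 printed citations (2 remaining named inputs: hLiu418 = `stmt-HodgeConjecture-24832`, h413 = `stmt-HodgeConjecture-24833`) until rung 0
closes; helper theorems about pinned definitions, closes no socket; count-neutral.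

## References
* [MoeglinWaldspurger1995] C. Mœglin, J.-L. Waldspurger, *Spectral decomposition and Eisenstein series* (1995), IV.1.10, IV.3.12.
* [KeysShahidi1988] D. Keys, F. Shahidi, *Artin L-functions and normalization of intertwining operators*, Ann. Sci. ÉNS 21 (1988), Thm. 5.1.
* [Rogawski1990] J. Rogawski, *Automorphic Representations of Unitary Groups in Three Variables*, Ann. of Math. Stud. 123 (1990), §13.6 (13.6.1) p. 208.
-/

set_option autoImplicit false
set_option linter.dupNamespace false  -- the mandated namespace repeats the summit's segment (`HodgeConjecture.HodgeConjecture`)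

noncomputable section

open MeasureTheory MeasureTheory.Measure Set NumberField IsDedekindDomain Filter Topology
open scoped NNReal ENNReal ComplexConjugate
open Literature.MeasureTheory.Group Literature.NumberTheory
open Literature.NumberTheory.Automorphic Literature.NumberTheory.Automorphic.UnitaryGroup AdelicGroupData
open Literature.NumberTheory.GaloisRepresentations
open Summit.HodgeConjecture.HodgeConjecture.Cruxes.H413.K2E1BorelEisensteinU
open Summit.HodgeConjecture.HodgeConjecture.Cruxes.H413.K2E1BLBorelSpacesU2Defs
open Summit.HodgeConjecture.HodgeConjecture.Cruxes.H413.K2E1BLBorelOperatorsU2Defs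
open Summit.HodgeConjecture.HodgeConjecture.Cruxes.H413.K2E1CharacterEisensteinU2Defs
open Summit.HodgeConjecture.HodgeConjecture.Cruxes.H413.K2E1ChiSectionSpaceU2Defs
open Summit.HodgeConjecture.HodgeConjecture.Cruxes.H413.K2E1ChiScatteringRealPolesM1CMTwoComplete (chi_scattering_real_poles_m1_complete_cm_two)
open Summit.HodgeConjecture.HodgeConjecture.Cruxes.H413.K2E1ChiScatteringCentreValueSignM1CMTwo (apply_half_eq_one_or_eq_neg_one_of_fe_of_conj)
open Summit.HodgeConjecture.HodgeConjecture.Cruxes.H413.K2E1ChiUnitaryAxisContinuationCMTwo (analyticAt_of_re_eq_half_of_fe_of_conj)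
open Summit.HodgeConjecture.HodgeConjecture.Cruxes.H413.K2E1ChiScatteringFunctionalEquationM1CMTwo (chi_scattering_fe_m1_cm_two)
open Summit.HodgeConjecture.HodgeConjecture.Cruxes.H413.K2E1ChiScatteringConjSymmetryM1CMTwo (chi_scattering_conj_symm_m1_cm_two exists_galTwist_cm)
open Summit.HodgeConjecture.HodgeConjecture.Cruxes.H413.K2E1ContSpecTraceNumbersU2Defs

namespace Summit.HodgeConjecture.HodgeConjecture.Cruxes.H413.K2E1ContSpecTraceNumbersCentreSqU2

variable (L : Type) [Field L] [NumberField L] [IsCMField L]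
variable [MeasurableSpace (quasiSplit (↥(maximalRealSubfield L)) L (IsCMField.complexConj L) 2).Adelic]


variable [BorelSpace (quasiSplit (↥(maximalRealSubfield L)) L (IsCMField.complexConj L) 2).Adelic] [MeasurableSpace (AdeleRing (𝓞 L) L)ˣ] [BorelSpace (AdeleRing (𝓞 L) L)ˣ]
variable (μ : Measure (quasiSplit (↥(maximalRealSubfield L)) L (IsCMField.complexConj L) 2).automorphicQuotient) [(quasiSplit (↥(maximalRealSubfield L)) L (IsCMField.complexConj L) 2).IsAutomorphicMeasure μ]
variable (νG : Measure (quasiSplit (↥(maximalRealSubfield L)) L (IsCMField.complexConj L) 2).Adelic) [νG.IsHaarMeasure] [νG.IsInvInvariant] [SFinite νG]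
variable (μK : Measure ↥((standardMaximalCompactGL 2 L).comap (adelicVal (↥(maximalRealSubfield L)) L (IsCMField.complexConj L) 2 ((StdForm.antidiagonal 2).over L)) : Subgroup (quasiSplit (↥(maximalRealSubfield L)) L (IsCMField.complexConj L) 2).Adelic)) [μK.IsHaarMeasure]
variable (νI : Measure (AdeleRing (𝓞 L) L)ˣ) [νI.IsHaarMeasure]
variable {𝓕I : Set (AdeleRing (𝓞 L) L)ˣ} (h𝓕I : IsIdeleClassDomain L 𝓕I)
variable (ν : Measure ↥(adelicUnipotent (↥(maximalRealSubfield L)) L (IsCMField.complexConj L) 2)) [ν.IsHaarMeasure] [ν.IsMulRightInvariant] [ν.IsInvInvariant]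
variable {𝓕 : Set ↥(adelicUnipotent (↥(maximalRealSubfield L)) L (IsCMField.complexConj L) 2)}
variable (h𝓕N : IsFundamentalDomain ↥(rationalUnipotent (↥(maximalRealSubfield L)) L (IsCMField.complexConj L) 2) 𝓕 ν) (h𝓕1 : ν 𝓕 = 1) (h𝓕c : IsCompact (closure 𝓕))
variable {β : (quasiSplit (↥(maximalRealSubfield L)) L (IsCMField.complexConj L) 2).Adelic → ℝ≥0∞}
variable (hβ : IsCoveringWeight ↥((arithmeticBorel (↥(maximalRealSubfield L)) L (IsCMField.complexConj L) 2).map (quasiSplit (↥(maximalRealSubfield L)) L (IsCMField.complexConj L) 2).arithmeticSubgroup.subtype) β)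
variable {μZ : Measure (borelQuotient (↥(maximalRealSubfield L)) L (IsCMField.complexConj L) 2)} [SFinite μZ]
variable (hμZ : ∀ f : borelQuotient (↥(maximalRealSubfield L)) L (IsCMField.complexConj L) 2 → ℝ≥0∞, Measurable f → ∫⁻ z, f z ∂μZ = ∫⁻ g, β g * f (toBorelQuotient (↥(maximalRealSubfield L)) L (IsCMField.complexConj L) 2 g) ∂νG)
variable {χ : HeckeCharacter L} (hχ : χ.IsUnitary) (hρ : ∀ r : ℝ≥0ˣ, χ (posRealIdele L r) = 1) (hsd : reflectChar (IsCMField.complexConj L) χ = χ)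
variable {φ : (quasiSplit (↥(maximalRealSubfield L)) L (IsCMField.complexConj L) 2).Adelic → ℂ}
variable (hφV : φ ∈ chiSectionSpace χ ((standardMaximalCompactGL 2 L).comap (adelicVal (↥(maximalRealSubfield L)) L (IsCMField.complexConj L) 2 ((StdForm.antidiagonal 2).over L)) : Subgroup (quasiSplit (↥(maximalRealSubfield L)) L (IsCMField.complexConj L) 2).Adelic) (fun _ => 1))
variable (hφc : Continuous φ) {Mφ : ℝ} (hφM : ∀ x, ‖φ x‖ ≤ Mφ)
variable (hφinf : ∀ a : arch (↥(maximalRealSubfield L)) L (IsCMField.complexConj L) 2 ((StdForm.antidiagonal 2).over L), φ (archToAdelic (↥(maximalRealSubfield L)) L (IsCMField.complexConj L) 2 _ a) = φ 1)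
variable (hφ1 : φ 1 ≠ 0) (hφ1r : conj (φ 1) = φ 1)

/-! ## §1 The conversion lemma of record -/

/-- **THE DEF IS THE FOURTH COORDINATE OF THE ONE CHOSEN TUPLE** (`rfl`).  Conversion lemma of record between the `def` spelling `scatteringScalarM1 …` and the
`Classical.choose` spelling of ★ `chi_scattering_real_poles_m1_complete_cm_two`'s package: consumers `rw [scatteringScalarM1_eq_choose]` and then project the clauses of the SAME
tuple (`(…).choose_spec.choose_spec.choose_spec.choose_spec.choose_spec`), at default heartbeats. [folklore] -/
theorem scatteringScalarM1_eq_choose : scatteringScalarM1 L μ νG μK νI h𝓕I ν h𝓕N h𝓕1 h𝓕c hβ hμZ hχ hρ hsd hφV hφc hφM hφinf hφ1 hφ1r = (chi_scattering_real_poles_m1_complete_cm_two L μ νG μK νI h𝓕I ν h𝓕N h𝓕1 h𝓕c hβ hμZ hχ hρ hsd hφV hφc hφM hφinf hφ1 hφ1r).choose_spec.choose_spec.choose_spec.choose default := rfl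

/-! ## §2 The centre value: `s(½) = ±1`, analyticity at `½` -/

/-- **`s(½) = 1 ∨ s(½) = -1`, AND `s` IS ANALYTIC AT `½`** for THE pinned scattering scalar.  PROOF: project the chosen tuple's clauses (basis read-back `hbV`, Eisenstein expansion
`hqφ`, normal form `hqNF`, constant term `hqcq`, pole-set clauses `hPc hPcd hPre`, analyticity `hqa`, tube formula); (FE) := ★ σ2 `chi_scattering_fe_m1_cm_two` on them (the
`• φ` form of `hqφ` summand-wise through `hbV`); (conj) := ★ `chi_scattering_conj_symm_m1_cm_two` on the tube formula (`χ` unitary and self-dual, `φ(1)` real, `φ` right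
`K_max`-invariant); conclude by the kernel-free ★ `apply_half_eq_one_or_eq_neg_one_of_fe_of_conj` and ★ `analyticAt_of_re_eq_half_of_fe_of_conj`.
[cite: MoeglinWaldspurger1995, IV.1.10 and IV.3.12] [cite: KeysShahidi1988, Thm. 5.1] -/
theorem scatteringScalarM1_half_eq_or_and_analyticAt :
    (scatteringScalarM1 L μ νG μK νI h𝓕I ν h𝓕N h𝓕1 h𝓕c hβ hμZ hχ hρ hsd hφV hφc hφM hφinf hφ1 hφ1r (1 / 2) = 1 ∨ scatteringScalarM1 L μ νG μK νI h𝓕I ν h𝓕N h𝓕1 h𝓕c hβ hμZ hχ hρ hsd hφV hφc hφM hφinf hφ1 hφ1r (1 / 2) = -1) ∧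
      AnalyticAt ℂ (scatteringScalarM1 L μ νG μK νI h𝓕I ν h𝓕N h𝓕1 h𝓕c hβ hμZ hχ hρ hsd hφV hφc hφM hφinf hφ1 hφ1r) (1 / 2) := by
  rw [scatteringScalarM1_eq_choose]
  -- the clauses of the ONE chosen tuple
  have h := (chi_scattering_real_poles_m1_complete_cm_two L μ νG μK νI h𝓕I ν h𝓕N h𝓕1 h𝓕c hβ hμZ hχ hρ hsd hφV hφc hφM hφinf hφ1 hφ1r).choose_spec.choose_spec.choose_spec.choose_spec.choose_spec
  have hbV := h.1
  have hqφ := h.2.1.2.1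
  have hqNF := h.2.1.2.2.2.1
  have hqcq := h.2.1.2.2.2.2.2.1
  have hPc := h.2.1.2.2.2.2.2.2.1
  have hPcd := h.2.1.2.2.2.2.2.2.2.1
  have hPre := h.2.1.2.2.2.2.2.2.2.2.1
  have hqa := h.2.1.2.2.2.2.2.2.2.2.2.2.1
  have htube := h.2.2.1
  have h𝓕₀ : ν 𝓕 ≠ 0 := by rw [h𝓕1]; exact one_ne_zero
  have hφ0 : φ ≠ 0 := fun h0 => hφ1 (by rw [h0, Pi.zero_apply])
  -- the `• φ` form of the Eisenstein expansion, summand by summand through the basis read-back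
  have hqφ' := fun z (hz : 1 < z.re) => (Finset.sum_congr rfl fun j _ => by rw [hbV j]).symm.trans (hqφ z hz)
  -- (FE) on the chosen clauses (★ σ2)
  have hFE := chi_scattering_fe_m1_cm_two L μ νG ν h𝓕N h𝓕c h𝓕₀ hβ hμZ hsd hφV hφc hφM hφinf hφ0 hqφ' hqcq hPc hPcd hPre hqa
  -- (conj) on the tube formula (★ `chi_scattering_conj_symm_m1_cm_two`)
  have hφK : ∀ k : (quasiSplit (↥(maximalRealSubfield L)) L (IsCMField.complexConj L) 2).Adelic,
      adelicVal (↥(maximalRealSubfield L)) L (IsCMField.complexConj L) 2 ((StdForm.antidiagonal 2).over L) k ∈ standardMaximalCompactGL 2 L → ∀ g, φ (g * k) = φ g :=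
    fun k hk g => by simpa only [one_mul] using apply_mul_of_mem hφV g ⟨k, hk⟩
  have hconj := chi_scattering_conj_symm_m1_cm_two L (exists_galTwist_cm L).choose_spec ν ((ν 𝓕).toReal⁻¹) hsd hχ (isChiSection_of_mem hφV) hφK hφ1r hφ1r hPc hPcd hPre
    (hqa default) htube
  exact ⟨apply_half_eq_one_or_eq_neg_one_of_fe_of_conj (hqNF default) hPcd hFE hconj,
    analyticAt_of_re_eq_half_of_fe_of_conj (hqNF default) hPcd hFE hconj (by norm_num)⟩

/-- **`s(½) = 1 ∨ s(½) = -1`** for THE pinned scattering scalar (the sign is Keys–Shahidi content, kept as a disjunction). [cite: KeysShahidi1988, Thm. 5.1]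
[cite: MoeglinWaldspurger1995, IV.1.10] -/
theorem scatteringScalarM1_half_eq_one_or_eq_neg_one : scatteringScalarM1 L μ νG μK νI h𝓕I ν h𝓕N h𝓕1 h𝓕c hβ hμZ hχ hρ hsd hφV hφc hφM hφinf hφ1 hφ1r (1 / 2) = 1 ∨ scatteringScalarM1 L μ νG μK νI h𝓕I ν h𝓕N h𝓕1 h𝓕c hβ hμZ hχ hρ hsd hφV hφc hφM hφinf hφ1 hφ1r (1 / 2) = -1 :=
  (scatteringScalarM1_half_eq_or_and_analyticAt L μ νG μK νI h𝓕I ν h𝓕N h𝓕1 h𝓕c hβ hμZ hχ hρ hsd hφV hφc hφM hφinf hφ1 hφ1r).1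

/-- **`s` IS ANALYTIC AT `½`.** [cite: MoeglinWaldspurger1995, IV.1.10 and IV.3.12] -/
theorem analyticAt_scatteringScalarM1_half : AnalyticAt ℂ (scatteringScalarM1 L μ νG μK νI h𝓕I ν h𝓕N h𝓕1 h𝓕c hβ hμZ hχ hρ hsd hφV hφc hφM hφinf hφ1 hφ1r) (1 / 2) :=
  (scatteringScalarM1_half_eq_or_and_analyticAt L μ νG μK νI h𝓕I ν h𝓕N h𝓕1 h𝓕c hβ hμZ hχ hρ hsd hφV hφc hφM hφinf hφ1 hφ1r).2

/-- **`s(½)² = 1`.** [cite: MoeglinWaldspurger1995, IV.1.10] [cite: KeysShahidi1988, Thm. 5.1] -/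
theorem scatteringScalarM1_half_sq : scatteringScalarM1 L μ νG μK νI h𝓕I ν h𝓕N h𝓕1 h𝓕c hβ hμZ hχ hρ hsd hφV hφc hφM hφinf hφ1 hφ1r (1 / 2) ^ 2 = 1 :=
  (scatteringScalarM1_half_eq_one_or_eq_neg_one L μ νG μK νI h𝓕I ν h𝓕N h𝓕1 h𝓕c hβ hμZ hχ hρ hsd hφV hφc hφM hφinf hφ1 hφ1r).elim (fun h => by rw [h, one_pow]) fun h => by rw [h, neg_one_sq]

/-- **`½` IS NOT IN THE SINGULAR SET** `scatteringPolesM1 …` of the pinned scalar. [cite: MoeglinWaldspurger1995, IV.1.10 and IV.3.12] -/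
theorem half_notMem_scatteringPolesM1 : (1 / 2 : ℂ) ∉ scatteringPolesM1 L μ νG μK νI h𝓕I ν h𝓕N h𝓕1 h𝓕c hβ hμZ hχ hρ hsd hφV hφc hφM hφinf hφ1 hφ1r :=
  not_not.2 (analyticAt_scatteringScalarM1_half L μ νG μK νI h𝓕I ν h𝓕N h𝓕1 h𝓕c hβ hμZ hχ hρ hsd hφV hφc hφM hφinf hφ1 hφ1r)

/-! ## §3 The trace numbers: `Tr(M_H(χ) I_{H,χ}(f)) = ± Tr I_{H,χ}(f)` -/

/-- **`Tr(M_H(χ) I_{H,χ}(f)) = Tr I_{H,χ}(f) ∨ Tr(M_H(χ) I_{H,χ}(f)) = - Tr I_{H,χ}(f)`** at the maximal level (`trMIH = s(½) · trIH`, `s(½) = ±1`). [cite: Rogawski1990, §13.6 (13.6.1) p. 208]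
[cite: KeysShahidi1988, Thm. 5.1] -/
theorem trMIH_m1_eq_or_eq_neg (f : (quasiSplit (↥(maximalRealSubfield L)) L (IsCMField.complexConj L) 2).Adelic → ℂ) :
    trMIH_m1 L μ νG μK νI h𝓕I ν h𝓕N h𝓕1 h𝓕c hβ hμZ hχ hρ hsd hφV hφc hφM hφinf hφ1 hφ1r f = trIH_m1 L νG φ f ∨ trMIH_m1 L μ νG μK νI h𝓕I ν h𝓕N h𝓕1 h𝓕c hβ hμZ hχ hρ hsd hφV hφc hφM hφinf hφ1 hφ1r f = -trIH_m1 L νG φ f := by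
  rw [trMIH_m1_def]
  exact (scatteringScalarM1_half_eq_one_or_eq_neg_one L μ νG μK νI h𝓕I ν h𝓕N h𝓕1 h𝓕c hβ hμZ hχ hρ hsd hφV hφc hφM hφinf hφ1 hφ1r).imp (fun h => by rw [h, one_mul]) fun h => by rw [h, neg_one_mul]

/-- **`(Tr(M_H(χ) I_{H,χ}(f)))² = (Tr I_{H,χ}(f))²`** at the maximal level. [cite: Rogawski1990, §13.6 (13.6.1) p. 208] -/
theorem trMIH_m1_sq (f : (quasiSplit (↥(maximalRealSubfield L)) L (IsCMField.complexConj L) 2).Adelic → ℂ) : trMIH_m1 L μ νG μK νI h𝓕I ν h𝓕N h𝓕1 h𝓕c hβ hμZ hχ hρ hsd hφV hφc hφM hφinf hφ1 hφ1r f ^ 2 = trIH_m1 L νG φ f ^ 2 := by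
  rw [trMIH_m1_def, mul_pow, scatteringScalarM1_half_sq, one_mul]

end Summit.HodgeConjecture.HodgeConjecture.Cruxes.H413.K2E1ContSpecTraceNumbersCentreSqU2

end
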